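import Literature.Computability.FineGrained.DiameterOVGraph
import Literature.Computability.FineGrained.SplitAndListOV
import HarnessLib

/-!
# Orthogonal Vectors to Diameter 2 vs 3: the word-RAM program (build phase)

The program behind `ovInTimePolyDim_of_diameterGapApprox_inTimeO` (`DiameterOVReduction.lean`;
L. Roditty, V. Vassilevska Williams, STOC 2013, §4 Thm. 9 in Orthogonal-Vectors form: an
`O(m^{2-ε})`-time algorithm distinguishing diameter `2` from `3` on sparse graphs gives an
`O(n^{2-ε} poly(d))`-time algorithm for OV), written — exactly like the grouping reduction of
`CliqueETHReductionProgram.lean` — as structured word-RAM code (`SProg`, logic `SProg.Achieves`)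
around one emulated run of the hypothetical Diameter program (`SProg.withSubrun`).

This file first records the Diameter instance `DiamRed.dInst I α` of an OV instance `I` as an
instance of `Cryptography.DiameterGapApprox α` (connected sparse graphs by edge lists, size =
number of listed entries), its accepted outputs (`D = 3` iff an orthogonal pair exists, for
`0 < α < 3/2`, `DiamRed.exists_of_mem_good`), and the word-level description of the Diameter
input `DiamRed.y I = encodeEdgeList (DiamRed.edges I) = nV :: ne :: DiamRed.body I` (the endpoints
block by block over `List.range`, bits read as naturals `DiamRed.bitA`, `DiamRed.bitB`; length
`2 + 2 ne`, entries `≤ 2 + 2 ne`, input width `Nat.size (2 + 2 ne)`). Then the program: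

* **the build** `DiamRed.pre kM cM` on the input `x = OV.encode I`: relocate the input
  (`SProg.relocate`); compute `n, d`, the number of entries `ne = 1 + 2d + 2n(1+d)`, the length
  `Ly = 2 + 2 ne` of the Diameter input, the number of vertices `nV = 2 + d + 2n` and the base `Bv`
  of the emulated cells (`setupA`); the emulated word size `ws = kM · size Ly` by the halving loop
  `CliqueRed.sizeLoop`, `Pw = 2^ws`, the value bound `V = (Pw - 1) + cM + Ly` and the environment
  registers (`setupV`); then EMIT, word by word at consecutive emulated cells and reduced modulo
  `Pw`, the Diameter input `Ly, nV, ne, 0, 1` (`header`), the hub–coordinate words (`loopC`), the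
  blocks of the two vector lists (`loopP`, reading the bits of `x` in input order through one
  pointer), and clear the scratch registers (`CliqueRed.clearRegs`);
* **the read-out** `DiamRed.post`: output `[1]` if the emulated cell `1` (the Diameter program's
  answer `D`) equals `3`, else `[0]`;
* ghost parameters `DiamRed.Params` (`I, kM, cM`), the word-size requirement `Params.Fits W`, the
  data written so far as `writeFrom Bv L (relocated x)` for the list `L` of emitted words, and the
  phase specifications `setupA_spec`, `setupV_spec`, `header_spec`, `loopC_spec`, `loopP_spec`,
  assembled in **`Params.pre_spec`**: the build ends within `Params.Tpre` steps in the closed-form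
  memory `Params.finMem`, whose emulated cells hold `(Ly :: y I) % Pw`.

## References

* L. Roditty, V. Vassilevska Williams, *Fast approximation algorithms for the diameter and radius
  of sparse graphs*, STOC 2013, §4 Thm. 9.
* V. Vassilevska Williams, *On some fine-grained questions in algorithms and complexity*,
  Proc. ICM 2018, §2 (the word RAM; algorithms calling an algorithm for another problem).
* T. Nipkow, G. Klein, *Concrete Semantics with Isabelle/HOL*, Springer 2014, §12.
-/

namespace Literature.Computability.FineGrained

open Cryptography Cryptography.WordRAM

namespace DiamRed

variable (I : OVInstance)

/-! ### The instance of `DiameterGapApprox α` -/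

/-- The Diameter instance of `I`: `nV I` vertices, edge list `edges I`. [cite: RodittyVassilevskaWilliamsSTOC2013, §4 Thm. 9 (proof)] -/
def inst : Σ n, List (Fin n × Fin n) := ⟨nV I, edges I⟩

/-- The Diameter instance of `I` as an instance of `DiameterGapApprox α` (it is connected).
[cite: RodittyVassilevskaWilliamsSTOC2013, §4 Thm. 9 (proof)] -/
def dInst (α : ℚ) : (DiameterGapApprox α).Inst := ⟨inst I, connected I⟩

/-- Its encoding is the edge-list encoding. [folklore] -/
theorem encode_dInst (α : ℚ) : (DiameterGapApprox α).encode (dInst I α) = encodeEdgeList (edges I) :=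
  rfl

/-- Its size is the number of listed entries `ne I = 1 + 2d + 2n(1+d)`. [folklore] -/
theorem size_dInst (α : ℚ) : (DiameterGapApprox α).size (dInst I α) = ne I := length_edges I

/-- Its accepted outputs are the one-word lists `[D]` with `diam / α ≤ D ≤ diam`. [folklore] -/
theorem good_dInst_iff (α : ℚ) (out : List ℕ) :
    out ∈ (DiameterGapApprox α).Good (dInst I α) ↔
      ∃ D : ℕ, out = [D] ∧ ((graph I).diam : ℚ) / α ≤ D ∧ D ≤ (graph I).diam :=
  Iff.rfl

/-- **An accepted output answers OV**: for `0 < α < 3/2`, an accepted output of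
`DiameterGapApprox α` on the instance is `[D]` with `D = 3` iff `I` has an orthogonal pair.
[cite: RodittyVassilevskaWilliamsSTOC2013, §4 Thm. 9 (Remark)] -/
theorem exists_of_mem_good {α : ℚ} (hα : 0 < α) (hα' : α < 3 / 2) {out : List ℕ}
    (h : out ∈ (DiameterGapApprox α).Good (dInst I α)) :
    ∃ D : ℕ, out = [D] ∧ (D = 3 ↔ I.HasOrthogonalPair) := by
  obtain ⟨D, rfl, hlo, hhi⟩ := (good_dInst_iff I α out).1 h
  exact ⟨D, rfl, eq_three_iff I hα hα' hlo hhi⟩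

/-! ### The input words -/

/-- The input of the Diameter program: the edge-list encoding of the instance. [folklore] -/
def y : List ℕ := encodeEdgeList (edges I)

/-- Bit `A p j` read at natural indices (`false` out of range). [folklore] -/
def bitA (p j : ℕ) : Bool := if h : p < I.n ∧ j < I.d then I.A ⟨p, h.1⟩ ⟨j, h.2⟩ else false

/-- Bit `B q j` read at natural indices (`false` out of range). [folklore] -/
def bitB (q j : ℕ) : Bool := if h : q < I.n ∧ j < I.d then I.B ⟨q, h.1⟩ ⟨j, h.2⟩ else false

/-- The words of the hub–coordinate edges: `0, 2+j, 1, 2+j` for each `j`. [folklore] -/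
def wordsC : List ℕ := (List.range I.d).flatMap fun j => [0, 2 + j, 1, 2 + j]

/-- The words of the coordinate entries of block `a_p`: `a_p`, then `c_j` or `a_p`. [folklore] -/
def wordsAj (p j : ℕ) : List ℕ := [2 + I.d + p, if bitA I p j then 2 + j else 2 + I.d + p]

/-- The words of block `a_p`: `0, a_p`, then its coordinate entries. [folklore] -/
def wordsA (p : ℕ) : List ℕ := 0 :: (2 + I.d + p) :: (List.range I.d).flatMap (wordsAj I p)

/-- The words of the coordinate entries of block `b_q`: `b_q`, then `c_j` or `b_q`. [folklore] -/
def wordsBj (q j : ℕ) : List ℕ :=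
  [2 + I.d + I.n + q, if bitB I q j then 2 + j else 2 + I.d + I.n + q]

/-- The words of block `b_q`: `1, b_q`, then its coordinate entries. [folklore] -/
def wordsB (q : ℕ) : List ℕ := 1 :: (2 + I.d + I.n + q) :: (List.range I.d).flatMap (wordsBj I q)

/-- The body of the input: the endpoints of all listed entries, in order. [folklore] -/
def body : List ℕ :=
  0 :: 1 :: (wordsC I ++ ((List.range I.n).flatMap (wordsA I) ++ (List.range I.n).flatMap (wordsB I)))

/-- The endpoint words of a list of vertex pairs. [folklore] -/
def ends {N : ℕ} (l : List (Fin N × Fin N)) : List ℕ := l.flatMap fun e => [(e.1 : ℕ), (e.2 : ℕ)]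

/-- `ends` of a cons. [folklore] -/
theorem ends_cons {N : ℕ} (e : Fin N × Fin N) (l : List (Fin N × Fin N)) :
    ends (e :: l) = (e.1 : ℕ) :: (e.2 : ℕ) :: ends l := rfl

/-- `ends` of an append. [folklore] -/
theorem ends_append {N : ℕ} (l l' : List (Fin N × Fin N)) : ends (l ++ l') = ends l ++ ends l' := by
  simp [ends, List.flatMap_append]

/-- `ends` of a `flatMap`. [folklore] -/
theorem ends_flatMap {N : ℕ} {β : Type} (l : List β) (f : β → List (Fin N × Fin N)) :
    ends (l.flatMap f) = l.flatMap fun b => ends (f b) := by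
  induction l with
  | nil => rfl
  | cons b l ih => rw [List.flatMap_cons, ends_append, ih, List.flatMap_cons]

/-- `ends` of a `map`. [folklore] -/
theorem ends_map {N : ℕ} {β : Type} (l : List β) (f : β → Fin N × Fin N) :
    ends (l.map f) = l.flatMap fun b => [((f b).1 : ℕ), ((f b).2 : ℕ)] := by
  induction l with
  | nil => rfl
  | cons b l ih => rw [List.map_cons, ends_cons, ih, List.flatMap_cons]; rfl

/-- `bitA` at indices in range. [folklore] -/
theorem bitA_eq (p : Fin I.n) (j : Fin I.d) : bitA I p j = I.A p j := by
  simp [bitA, p.2, j.2]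

/-- `bitB` at indices in range. [folklore] -/
theorem bitB_eq (q : Fin I.n) (j : Fin I.d) : bitB I q j = I.B q j := by
  simp [bitB, q.2, j.2]

/-- The endpoint words of the hub–coordinate edges. [folklore] -/
theorem ends_edgesC : ends (edgesC I) = wordsC I := by
  unfold edgesC wordsC
  rw [ends_flatMap, ← List.map_coe_finRange_eq_range, List.flatMap_map]
  rfl

/-- The endpoint words of block `a_p`. [folklore] -/
theorem ends_blockA (p : Fin I.n) : ends (blockA I p) = wordsA I p := by
  unfold blockA wordsA
  rw [ends_cons, ends_map, ← List.map_coe_finRange_eq_range, List.flatMap_map]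
  simp only [vT1, vA]
  congr 1; congr 1
  apply List.flatMap_congr
  intro j _
  simp only [wordsAj, bitA_eq]
  cases I.A p j <;> simp [vC]

/-- The endpoint words of block `b_q`. [folklore] -/
theorem ends_blockB (q : Fin I.n) : ends (blockB I q) = wordsB I q := by
  unfold blockB wordsB
  rw [ends_cons, ends_map, ← List.map_coe_finRange_eq_range, List.flatMap_map]
  simp only [vT2, vB]
  congr 1; congr 1
  apply List.flatMap_congr
  intro j _
  simp only [wordsBj, bitB_eq]
  cases I.B q j <;> simp [vC]

/-- The endpoint words of all blocks of the first list. [folklore] -/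
theorem flatMap_ends_blockA :
    ((List.finRange I.n).flatMap fun p => ends (blockA I p)) = (List.range I.n).flatMap (wordsA I) := by
  rw [← List.map_coe_finRange_eq_range, List.flatMap_map]
  exact List.flatMap_congr fun p _ => ends_blockA I p

/-- The endpoint words of all blocks of the second list. [folklore] -/
theorem flatMap_ends_blockB :
    ((List.finRange I.n).flatMap fun q => ends (blockB I q)) = (List.range I.n).flatMap (wordsB I) := by
  rw [← List.map_coe_finRange_eq_range, List.flatMap_map]
  exact List.flatMap_congr fun q _ => ends_blockB I q

/-- The endpoint words of the whole edge list. [folklore] -/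
theorem ends_edges : ends (edges I) = body I := by
  unfold edges body
  rw [ends_cons, ends_append, ends_append, ends_flatMap, ends_flatMap, ends_edgesC,
    flatMap_ends_blockA, flatMap_ends_blockB]
  rfl

/-- **The input words**: `y I = nV :: ne :: body`. [folklore] -/
theorem y_eq : y I = nV I :: ne I :: body I := by
  unfold y encodeEdgeList
  rw [length_edges, ← ends_edges]; rfl

/-- The length of `wordsC`: `4 d`. [folklore] -/
theorem length_wordsC : (wordsC I).length = 4 * I.d := by
  simp [wordsC, List.length_flatMap]; ring

/-- The length of a block `wordsA`: `2 + 2 d`. [folklore] -/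
theorem length_wordsA (p : ℕ) : (wordsA I p).length = 2 + 2 * I.d := by
  simp [wordsA, wordsAj, List.length_flatMap]; ring

/-- The length of a block `wordsB`: `2 + 2 d`. [folklore] -/
theorem length_wordsB (q : ℕ) : (wordsB I q).length = 2 + 2 * I.d := by
  simp [wordsB, wordsBj, List.length_flatMap]; ring

/-- The length of the body: `2 ne`. [folklore] -/
theorem length_body : (body I).length = 2 * ne I := by
  simp only [body, List.length_cons, List.length_append, length_wordsC, List.length_flatMap,
    length_wordsA, length_wordsB, List.map_const', List.sum_replicate, smul_eq_mul, List.length_range, ne]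
  ring

/-- **The length of the input**: `2 + 2 ne`. [folklore] -/
theorem length_y : (y I).length = 2 + 2 * ne I := by
  rw [y_eq, List.length_cons, List.length_cons, length_body]; ring

/-- `nV ≤ 2 + 2 ne`. [folklore] -/
theorem nV_le : nV I ≤ 2 + 2 * ne I := by unfold nV ne; nlinarith

/-- Every word of the body is a vertex number `< nV`. [folklore] -/
theorem lt_of_mem_body {v : ℕ} (hv : v ∈ body I) : v < nV I := by
  unfold nV
  simp only [body, wordsC, wordsA, wordsAj, wordsB, wordsBj, List.mem_cons, List.mem_append,
    List.mem_flatMap, List.mem_range, List.not_mem_nil, or_false] at hv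
  rcases hv with rfl | rfl | ⟨j, hj, rfl | rfl | rfl | rfl⟩ | ⟨p, hp, rfl | rfl | ⟨j, hj, rfl | rfl⟩⟩ |
    ⟨q, hq, rfl | rfl | ⟨j, hj, rfl | rfl⟩⟩
  all_goals first | omega | (split <;> omega)

/-- **Every input word is at most the input length.** [folklore] -/
theorem le_of_mem_y {v : ℕ} (hv : v ∈ y I) : v ≤ 2 + 2 * ne I := by
  rw [y_eq] at hv
  simp only [List.mem_cons] at hv
  rcases hv with rfl | rfl | hv
  · exact nV_le I
  · omega
  · exact ((lt_of_mem_body I hv).le.trans (nV_le I))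

/-- **The input width** of `y I` is `Nat.size (2 + 2 ne)` (the length dominates every word).
[folklore] -/
theorem inputWidth_y : inputWidth (y I) = Nat.size (2 + 2 * ne I) := by
  unfold inputWidth
  rw [length_y]
  congr 1
  refine le_antisymm (max_le le_rfl ?_) (le_max_left _ _)
  exact foldr_max_one_le (by omega) fun v hv => le_of_mem_y I hv

end DiamRed

end Literature.Computability.FineGrained

namespace Literature.Computability.FineGrained

open Cryptography Cryptography.WordRAM Cryptography.WordRAM.SProg CliqueRed

namespace DiamRed

/-! ### Register map

`0 = X` (base of the relocated input, `x[j]` in cell `X + j`), `1 = X - 1` (set by `relocate`);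
`2 = n`, `3 = d`, `4 = ne`, `5 = Ly = 2 + 2 ne`, `6 = nV`; the emulator's layout (`CliqueRed.lay`)
`10 = Bv`, `11 = Sv`, `12 = Gv (= 0)`, `13 = Pw = 2^ws`, temporaries `14–16`; `17` post;
scratch `20–23` (setup, emitted value), `30 = op` (emulated cell being written), `31 = rp` (input
bit being read), `32–38` (loop counters, indices, vertex numbers). -/

/-- Emit the value of operand `v`, reduced modulo `Pw`, at the cell `op` and advance `op`.
[folklore] -/
def emit (v : Operand) : List OpSpec :=
  [(.mod, r 20, v, r 13), (.band, pt 30, r 20, r 20), (.add, r 30, r 30, im 1)]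

/-- Setup, part 1: `n, d, ne, Ly, nV, Bv`, and `r21 := Ly`, `r22 := 0` for the size loop.
[folklore] -/
def setupA : SProg := block [
  (.band, r 2, pt 0, pt 0),
  (.add, r 20, r 0, im 1), (.band, r 3, pt 20, pt 20),
  (.add, r 4, r 3, im 1), (.mul, r 4, r 4, r 2), (.add, r 4, r 4, r 3), (.mul, r 4, r 4, im 2),
  (.add, r 4, r 4, im 1),
  (.mul, r 5, r 4, im 2), (.add, r 5, r 5, im 2),
  (.mul, r 6, r 2, im 2), (.add, r 6, r 6, r 3), (.add, r 6, r 6, im 2),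
  (.sub, r 10, r 0, im 101), (.add, r 10, r 10, r 0),
  (.add, r 21, r 5, im 0), (.band, r 22, im 0, im 0)]

/-- Setup, part 2 (after `CliqueRed.sizeLoop` has put `size Ly` in `r22`): `ws = kM · size Ly`,
`Pw = 2^ws`, `V = (Pw - 1) + cM + Ly` in `r23`, `Sv = Bv + V + 1`, `Gv = 0`. [folklore] -/
def setupV (kM cM : ℕ) : SProg := block [
  (.mul, r 22, r 22, im kM), (.shl, r 13, im 1, r 22), (.sub, r 23, r 13, im 1),
  (.add, r 23, r 23, im cM), (.add, r 23, r 23, r 5),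
  (.add, r 11, r 10, r 23), (.add, r 11, r 11, im 1), (.band, r 12, im 0, im 0)]

/-- The header of the emulated input: cell `0` holds `Ly`, then `nV, ne` and the first entry
`t₁ t₂ = 0, 1` (all modulo `Pw`), emitted from `op = Bv`. [folklore] -/
def header : SProg := block ([(.add, r 30, r 10, im 0)] ++ emit (r 5) ++ emit (r 6) ++ emit (r 4) ++
  emit (im 0) ++ emit (im 1))

/-- One hub–coordinate pair of entries: `0, 2+j, 1, 2+j`; advance `j`. [folklore] -/
def bodyC : SProg := block (emit (im 0) ++ [(.add, r 36, im 2, r 35)] ++ emit (r 36) ++ emit (im 1) ++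
  emit (r 36) ++ [(.add, r 35, r 35, im 1), (.sub, r 34, r 34, im 1)])

/-- The hub–coordinate entries, `j = 0, …, d - 1`. [folklore] -/
def loopC : SProg := seqs [block [(.band, r 35, im 0, im 0), (.band, r 34, r 3, r 3)], whilenz (r 34) bodyC]

/-- One coordinate entry of a vector block: the vector vertex `r36`, then — reading the next input
bit `b` through `rp` — the vertex `b · (2 + j) + (1 - b) · r36`, i.e. the coordinate vertex `2 + j`
if the bit is `1` and the vector vertex again (a padding loop) if it is `0`; advance `j`.
[folklore] -/
def bodyJ : SProg := block (emit (r 36) ++ [(.band, r 37, pt 31, pt 31), (.add, r 31, r 31, im 1),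
  (.add, r 39, im 2, r 35), (.mul, r 38, r 37, r 39), (.sub, r 40, im 1, r 37), (.mul, r 40, r 40, r 36),
  (.add, r 38, r 38, r 40)] ++ emit (r 38) ++ [(.add, r 35, r 35, im 1), (.sub, r 34, r 34, im 1)])

/-- One vector block: the vector vertex `r36 := 2 + d (+ n) + p`, the hub entry `lead, r36`, the
`d` coordinate entries; advance `p`. (`lead = 0`, `extra = []` for the first list; `lead = 1`,
`extra = [r36 += n]` for the second.) [folklore] -/
def bodyP (lead : ℕ) (extra : List OpSpec) : SProg := seqs [
  block ([(.add, r 36, im 2, r 3)] ++ extra ++ [(.add, r 36, r 36, r 33)] ++ emit (im lead) ++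
    emit (r 36) ++ [(.band, r 35, im 0, im 0), (.band, r 34, r 3, r 3)]),
  whilenz (r 34) bodyJ,
  block [(.add, r 33, r 33, im 1), (.sub, r 32, r 32, im 1)]]

/-- The blocks of one vector list, `p = 0, …, n - 1`. [folklore] -/
def loopP (lead : ℕ) (extra : List OpSpec) : SProg :=
  seqs [block [(.band, r 33, im 0, im 0), (.band, r 32, r 2, r 2)], whilenz (r 32) (bodyP lead extra)]

/-- **The build**: relocate, set up, emit the Diameter input into the emulated cells, clear the
scratch registers. (`kM`, `cM`: word-size constant and largest constant of the Diameter program.)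
[folklore] -/
def pre (kM cM : ℕ) : SProg := seqs [
  relocate, setupA, sizeLoop, setupV kM cM, header, loopC,
  block [(.add, r 31, r 0, im 2)], loopP 0 [], loopP 1 [(.add, r 36, r 36, r 2)], clearRegs]

/-- **The read-out**: output `[1]` if the emulated cell `1` (the Diameter program's answer) is `3`,
else `[0]`. [folklore] -/
def post : SProg := block [(.add, r 17, r 10, im 1), (.band, r 1, pt 17, pt 17), (.eq, r 1, r 1, im 3),
  (.band, r 0, im 1, im 1)]

/-- **The OV program**: Orthogonal Vectors by one emulated run of the Diameter program `M`.
[folklore] -/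
def ovProgram (M : Program) (kM : ℕ) : Program :=
  withSubrun (pre kM M.maxConst) lay M post

/-- Blocks and the loops above are query-free. [folklore] -/
theorem pre_queryFree (kM cM : ℕ) : (pre kM cM).QueryFree := by
  refine seqs_queryFree ?_
  simp only [List.mem_cons, List.not_mem_nil, or_false]
  rintro s (rfl | rfl | rfl | rfl | rfl | rfl | rfl | rfl | rfl | rfl)
  · exact relocate_queryFree
  · exact block_queryFree _
  · exact block_queryFree _
  · exact block_queryFree _
  · exact block_queryFree _
  · simp [loopC, bodyC, seqs, QueryFree, block_queryFree]
  · exact block_queryFree _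
  · simp [loopP, bodyP, bodyJ, seqs, QueryFree, block_queryFree]
  · simp [loopP, bodyP, bodyJ, seqs, QueryFree, block_queryFree]
  · exact block_queryFree _

/-- The read-out is query-free. [folklore] -/
theorem post_queryFree : post.QueryFree := block_queryFree _

/-- The OV program is deterministic. [folklore] -/
theorem ovProgram_isDeterministic (M : Program) (kM : ℕ) : (ovProgram M kM).IsDeterministic :=
  withSubrun_isDeterministic _ _ _ _

/-- The OV program is oracle-free. [folklore] -/
theorem ovProgram_isOracleFree (M : Program) (kM : ℕ) : (ovProgram M kM).IsOracleFree :=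
  withSubrun_isOracleFree (pre_queryFree _ _) post_queryFree _ _

/-! ### Ghost parameters of a run -/

/-- The data of a run: the OV instance and the word-size constant `kM` and largest constant `cM`
of the Diameter program. [folklore] -/
structure Params where
  /-- The OV instance. -/
  I : OVInstance
  /-- The word-size constant of the Diameter program. -/
  kM : ℕ
  /-- The largest constant of the Diameter program. -/
  cM : ℕ

namespace Params

noncomputable section

variable (g : Params)

/-- The input words. [folklore] -/
def x : List ℕ := OV.encode g.I
/-- The input length `Lx = 2 + 2 n d`. [folklore] -/
def Lx : ℕ := g.x.length
/-- The base `X` of the relocated input: `x[j]` sits in cell `X + j`. [folklore] -/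
def X : ℕ := g.Lx + 101
/-- The number of listed entries of the Diameter instance. [folklore] -/
def nE : ℕ := ne g.I
/-- The length of the Diameter input `y`. [folklore] -/
def Ly : ℕ := 2 + 2 * g.nE
/-- Base of the emulated cells (just above the relocated input). [folklore] -/
def Bv : ℕ := g.X + g.Lx
/-- The emulated word size `ws = kM · size Ly`. [folklore] -/
def ws : ℕ := g.kM * Nat.size g.Ly
/-- The emulated modulus `Pw = 2^ws`. [folklore] -/
def Pw : ℕ := 2 ^ g.ws
/-- The value bound `V = (Pw - 1) + cM + Ly` of the emulation. [folklore] -/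
def V : ℕ := g.Pw - 1 + g.cM + g.Ly
/-- Base of the stamps. [folklore] -/
def Sv : ℕ := g.Bv + g.V + 1
/-- The emulator environment: cells at `Bv`, stamps at `Sv`, generation `0`, word size `ws`,
region size `V + 1`. [folklore] -/
def env : Env := ⟨g.Bv, g.Sv, 0, g.ws, g.V + 1⟩
/-- The Diameter input. [folklore] -/
def yv : List ℕ := y g.I
/-- **The emitted words**: the Diameter input preceded by its length, reduced modulo `Pw` — the
initial memory of the Diameter program at word size `ws`. [folklore] -/
def emitted : List ℕ := (g.Ly :: g.yv).map (· % g.Pw)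

/-- `Lx = 2 + 2 n d`. [folklore] -/
theorem Lx_eq : g.Lx = 2 + 2 * (g.I.n * g.I.d) := length_OV_encode g.I

/-- `|y| = Ly`. [folklore] -/
theorem length_yv : g.yv.length = g.Ly := length_y g.I

/-- `|emitted| = Ly + 1`. [folklore] -/
theorem length_emitted : g.emitted.length = g.Ly + 1 := by
  rw [emitted, List.length_map, List.length_cons, length_yv]

/-- **Word-size requirements** of a run at word size `W`: the stamps fit (`Sv + V + 1 ≤ 2 ^ W`), the
emulated word size is below `W`, and the input width is at most `W`. [folklore] -/
structure Fits (W : ℕ) : Prop where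
  top : g.Sv + g.V + 1 ≤ 2 ^ W
  ws_lt : g.ws < W
  width : inputWidth g.x ≤ W

/-- Under `Fits`, the input words fit. [folklore] -/
theorem Fits.input {g : Params} {W : ℕ} (h : g.Fits W) : ∀ v ∈ g.x, v < 2 ^ W := fun v hv =>
  lt_of_lt_of_le (lt_two_pow_inputWidth_of_mem g.x v hv) (Nat.pow_le_pow_right Nat.two_pos h.width)

/-- The standard linear facts about the ghost parameters under `Fits`. [folklore] -/
theorem facts {W : ℕ} (hF : g.Fits W) :
    g.X = g.Lx + 101 ∧ g.Bv = g.X + g.Lx ∧ g.Sv = g.Bv + g.V + 1 ∧ g.Sv + g.V + 1 ≤ 2 ^ W ∧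
    g.V = g.Pw - 1 + g.cM + g.Ly ∧ g.Ly = 2 + 2 * g.nE ∧ 1 ≤ g.Pw ∧ g.Pw < 2 ^ W ∧ 2 ≤ g.Lx ∧
    g.I.n * g.I.d ≤ g.Lx ∧ g.I.n ≤ g.nE ∧ g.I.d ≤ g.nE ∧ g.I.n * (1 + g.I.d) ≤ g.nE ∧
    nV g.I ≤ g.Ly ∧ g.nE = 1 + 2 * g.I.d + 2 * (g.I.n * (1 + g.I.d)) ∧
    g.Lx = 2 + 2 * (g.I.n * g.I.d) ∧ nV g.I = 2 + g.I.d + 2 * g.I.n := by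
  have hLx := g.Lx_eq
  have hPw : g.Pw < 2 ^ W := Nat.pow_lt_pow_right (by norm_num) hF.ws_lt
  refine ⟨rfl, rfl, rfl, hF.top, rfl, rfl, Nat.one_le_two_pow, hPw, by omega, by omega, ?_, ?_, ?_,
    nV_le g.I, rfl, hLx, rfl⟩
  · unfold nE ne; nlinarith
  · unfold nE ne; nlinarith
  · unfold nE ne; nlinarith

end

end Params

/-! ### Written data -/

/-- `writeFrom base L mem`: the memory `mem` with the words of `L` written at `base, base + 1, …`.
[folklore] -/
def writeFrom (base : ℕ) (L : List ℕ) (mem : ℕ → ℕ) : ℕ → ℕ := fun a =>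
  if base ≤ a ∧ a < base + L.length then L.getD (a - base) 0 else mem a

/-- Below the base nothing is written. [folklore] -/
theorem writeFrom_of_lt {base : ℕ} (L : List ℕ) (mem : ℕ → ℕ) {a : ℕ} (ha : a < base) :
    writeFrom base L mem a = mem a := by
  unfold writeFrom; rw [if_neg (by omega)]

/-- Past the written words nothing is written. [folklore] -/
theorem writeFrom_of_le {base : ℕ} (L : List ℕ) (mem : ℕ → ℕ) {a : ℕ} (ha : base + L.length ≤ a) :
    writeFrom base L mem a = mem a := by
  unfold writeFrom; rw [if_neg (by omega)]

/-- The written words. [folklore] -/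
theorem writeFrom_base_add {base : ℕ} (L : List ℕ) (mem : ℕ → ℕ) {i : ℕ} (hi : i < L.length) :
    writeFrom base L mem (base + i) = L.getD i 0 := by
  unfold writeFrom; rw [if_pos ⟨by omega, by omega⟩, Nat.add_sub_cancel_left]

/-- Writing nothing. [folklore] -/
@[simp] theorem writeFrom_nil (base : ℕ) (mem : ℕ → ℕ) : writeFrom base [] mem = mem := by
  funext a; unfold writeFrom; rw [if_neg (by simp)]

/-- **Emitting one more word**: updating the cell after the written words extends the list.
[folklore] -/
theorem update_writeFrom (base : ℕ) (L : List ℕ) (mem : ℕ → ℕ) (v : ℕ) :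
    Function.update (writeFrom base L mem) (base + L.length) v = writeFrom base (L ++ [v]) mem := by
  funext a
  by_cases ha : a = base + L.length
  · subst ha
    rw [Function.update_self, writeFrom_base_add _ _ (by simp), List.getD_eq_getElem _ _ (by simp)]
    simp
  · rw [Function.update_of_ne ha]
    unfold writeFrom
    by_cases hin : base ≤ a ∧ a < base + L.length
    · rw [if_pos hin, if_pos ⟨hin.1, by simp; omega⟩, List.getD_eq_getElem _ _ (by omega),
        List.getD_eq_getElem _ _ (by simp; omega), List.getElem_append_left (by omega)]
    · rw [if_neg hin, if_neg (by simp; omega)]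

namespace Params

variable (g : Params) {W : ℕ} {O : List ℕ → List ℕ}

/-! ### Register conventions -/

/-- The registers after the setup: `X, n, d, ne, Ly, nV, Bv`. [folklore] -/
structure Regs (m : ℕ → ℕ) : Prop where
  r0 : m 0 = g.X
  r2 : m 2 = g.I.n
  r3 : m 3 = g.I.d
  r4 : m 4 = g.nE
  r5 : m 5 = g.Ly
  r6 : m 6 = nV g.I
  r10 : m 10 = g.Bv

/-- The environment registers: `Sv, Gv = 0, Pw`. [folklore] -/
structure ERegs (m : ℕ → ℕ) : Prop where
  r11 : m 11 = g.Sv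
  r12 : m 12 = 0
  r13 : m 13 = g.Pw

variable {g}

/-- `Regs` survives changes above register `10`. [folklore] -/
theorem Regs.of_frame {m m' : ℕ → ℕ} (h : g.Regs m) (hf : ∀ a, a ≤ 10 → m' a = m a) : g.Regs m' :=
  ⟨(hf 0 (by omega)).trans h.r0, (hf 2 (by omega)).trans h.r2, (hf 3 (by omega)).trans h.r3,
    (hf 4 (by omega)).trans h.r4, (hf 5 (by omega)).trans h.r5, (hf 6 (by omega)).trans h.r6,
    (hf 10 (by omega)).trans h.r10⟩

/-- `ERegs` survives changes outside `11–13`. [folklore] -/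
theorem ERegs.of_frame {m m' : ℕ → ℕ} (h : g.ERegs m) (hf : ∀ a, 11 ≤ a → a ≤ 13 → m' a = m a) :
    g.ERegs m' :=
  ⟨(hf 11 (by omega) (by omega)).trans h.r11, (hf 12 (by omega) (by omega)).trans h.r12,
    (hf 13 (by omega) (by omega)).trans h.r13⟩

variable (g)

/-! ### Reading the relocated input -/

/-- Cell `0` after relocation holds `X`. [folklore] -/
@[simp] theorem relocated_zero' : relocated g.x 0 = g.X := by
  rw [relocated_zero]; rfl

/-- Cell `1` after relocation holds `X - 1`. [folklore] -/
@[simp] theorem relocated_one' : relocated g.x 1 = g.X - 1 := by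
  rw [relocated_one]; unfold X Lx; omega

/-- The relocated input: `x[j]` sits in cell `X + j` (and `0` past the input). [folklore] -/
theorem relocated_X_add (j : ℕ) : relocated g.x (g.X + j) = g.x.getD j 0 := by
  by_cases hj : j < g.Lx
  · have := relocated_base_add g.x (i := j + 1) (by omega) (by unfold Lx at hj; omega)
    rw [show g.x.length + 100 + (j + 1) = g.X + j by unfold X Lx; omega] at this
    rw [this]; rfl
  · rw [relocated_of_lt g.x (by unfold X Lx at *; omega),
      List.getD_eq_default _ _ (by unfold Lx at hj; omega)]

/-- Everything from `Bv` on is `0` after relocation. [folklore] -/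
theorem relocated_of_Bv_le {a : ℕ} (ha : g.Bv ≤ a) : relocated g.x a = 0 :=
  relocated_of_lt g.x (by unfold Bv X Lx at ha; omega)

/-- Word `0` of the input is `n`. [folklore] -/
theorem relocated_X : relocated g.x g.X = g.I.n := by
  have := g.relocated_X_add 0
  rw [Nat.add_zero] at this
  rw [this]; unfold x; rw [List.getD_eq_getElem?_getD, OV_encode_getElem?_zero]; rfl

/-- Word `1` of the input is `d`. [folklore] -/
theorem relocated_X_one : relocated g.x (g.X + 1) = g.I.d := by
  rw [g.relocated_X_add 1]; unfold x; rw [List.getD_eq_getElem?_getD, OV_encode_getElem?_one]; rfl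

/-- The bits of the first list, in input order. [folklore] -/
theorem x_getD_bitA {p j : ℕ} (hp : p < g.I.n) (hj : j < g.I.d) :
    g.x.getD (2 + (p * g.I.d + j)) 0 = (bitA g.I p j).toNat := by
  have := OV_encode_getElem?_A g.I ⟨p, hp⟩ ⟨j, hj⟩
  unfold x; rw [List.getD_eq_getElem?_getD, this, Option.getD_some, bitA, dif_pos ⟨hp, hj⟩]

/-- The bits of the second list, in input order. [folklore] -/
theorem x_getD_bitB {q j : ℕ} (hq : q < g.I.n) (hj : j < g.I.d) :
    g.x.getD (2 + (g.I.n * g.I.d + (q * g.I.d + j))) 0 = (bitB g.I q j).toNat := by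
  have := OV_encode_getElem?_B g.I ⟨q, hq⟩ ⟨j, hj⟩
  unfold x; rw [List.getD_eq_getElem?_getD, this, Option.getD_some, bitB, dif_pos ⟨hq, hj⟩]

/-! ### The setup phase -/

/-- **Setup, part 1.** From the relocated memory, `setupA` computes the registers `Regs`, leaves
`r21 = Ly`, `r22 = 0`, and does not touch the data. [folklore] -/
theorem setupA_spec (hF : g.Fits W) :
    Achieves W O setupA (relocated g.x)
      (fun m => g.Regs m ∧ m 21 = g.Ly ∧ m 22 = 0 ∧ ∀ a, 100 ≤ a → m a = relocated g.x a) 17 := by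
  obtain ⟨hX, hBv, hSv, htop, hV, hLy, hPw1, hPwW, hLx2, hndLx, hnE, hdE, hndE, hnV, hnEdef, hLxdef, hnVdef⟩ :=
    g.facts hF
  have hn : relocated g.x g.X = g.I.n := g.relocated_X
  have hd : relocated g.x (g.X + 1) = g.I.d := g.relocated_X_one
  have hnE' : ((g.I.d + 1) * g.I.n + g.I.d) * 2 + 1 = g.nE := by unfold nE ne; ring
  have hnV' : g.I.n * 2 + g.I.d + 2 = nV g.I := by unfold nV; ring
  have h1 : (g.I.d + 1) * g.I.n ≤ g.nE := by unfold nE ne; nlinarith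
  refine achieves_block_of_eq (fun m' hm' => ?_) le_rfl
  simp (disch := first | omega | decide) only [execOps_cons, execOps_nil, execOp, Operand.write,
    Operand.read, merge_apply_of_lt, merge_apply_of_le, update_merge_of_lt, Function.update_self,
    Function.update_of_ne, BinOp.eval_add_of_lt, BinOp.eval_sub_of_le, BinOp.eval_mul_of_lt,
    BinOp.eval_band, Nat.and_self, relocated_zero', hn, hd, hnE', hnV'] at hm'
  subst hm'
  refine ⟨⟨?_, ?_, ?_, ?_, ?_, ?_, ?_⟩, ?_, ?_, fun a ha => ?_⟩
  all_goals (try simp (disch := first | omega | decide) only [merge_apply_of_lt,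
    merge_apply_of_le, Function.update_self, Function.update_of_ne])
  all_goals (try simp only [relocated_zero'])
  all_goals omega

/-- **Setup, part 2.** From the registers of `setupA` and `r22 = size Ly`, `setupV` sets the
environment registers `Sv, Gv = 0, Pw` (`ERegs`) and `r23 = V`, keeping `Regs` and the data.
[folklore] -/
theorem setupV_spec (hF : g.Fits W) {m : ℕ → ℕ} (hR : g.Regs m) (h22 : m 22 = Nat.size g.Ly)
    (hD : ∀ a, 100 ≤ a → m a = relocated g.x a) :
    Achieves W O (setupV g.kM g.cM) m
      (fun m' => g.Regs m' ∧ g.ERegs m' ∧ ∀ a, 100 ≤ a → m' a = relocated g.x a) 8 := by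
  obtain ⟨hX, hBv, hSv, htop, hV, hLy, hPw1, hPwW, hLx2, hndLx, hnE, hdE, hndE, hnV, hnEdef, hLxdef, hnVdef⟩ :=
    g.facts hF
  have hwsW : g.ws < W := hF.ws_lt
  have hW : W < 2 ^ W := Nat.lt_two_pow_self
  have hws : Nat.size g.Ly * g.kM = g.ws := Nat.mul_comm _ _
  have hPw : 2 ^ g.ws = g.Pw := rfl
  obtain ⟨r0, r2, r3, r4, r5, r6, r10⟩ := hR
  refine achieves_block_of_eq (fun m' hm' => ?_) le_rfl
  simp (disch := first | omega | decide) only [execOps_cons, execOps_nil, execOp, Operand.write,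
    Operand.read, merge_apply_of_lt, update_merge_of_lt, Function.update_self, Function.update_of_ne,
    BinOp.eval_add_of_lt, BinOp.eval_sub_of_le, BinOp.eval_mul_of_lt, BinOp.eval_shl_of_lt,
    BinOp.eval_band, Nat.and_self, Nat.one_mul, h22, hws, hPw, r5, r10] at hm'
  subst hm'
  refine ⟨⟨?_, ?_, ?_, ?_, ?_, ?_, ?_⟩, ⟨?_, ?_, ?_⟩, fun a ha => ?_⟩
  all_goals (try simp (disch := first | omega | decide) only [merge_apply_of_lt,
    merge_apply_of_le, Function.update_self, Function.update_of_ne])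
  all_goals first | assumption | omega | exact hD _ ha

/-! ### Emitting -/

/-- Emitting one more word (address supplied as an equation). [folklore] -/
theorem update_writeFrom_of_eq {base a : ℕ} {L : List ℕ} {mem : ℕ → ℕ} (v : ℕ)
    (h : a = base + L.length) :
    Function.update (writeFrom base L mem) a v = writeFrom base (L ++ [v]) mem := by
  subst h; exact update_writeFrom base L mem v

/-- `writeFrom` only reads the underlying memory at the address itself. [folklore] -/
theorem _root_.Literature.Computability.FineGrained.DiamRed.writeFrom_apply_congr {base : ℕ}
    (L : List ℕ) {m m' : ℕ → ℕ} {a : ℕ} (h : m a = m' a) :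
    writeFrom base L m a = writeFrom base L m' a := by
  unfold writeFrom; split_ifs <;> [rfl; exact h]

/-- The header words `Ly, nV, ne, 0, 1`. [folklore] -/
def P0 : List ℕ := [g.Ly, nV g.I, g.nE, 0, 1]

/-- The emitted words of a prefix: reduced modulo `Pw`. [folklore] -/
def red (P : List ℕ) : List ℕ := P.map (· % g.Pw)

/-- `red` of an append. [folklore] -/
@[simp] theorem red_append (P Q : List ℕ) : g.red (P ++ Q) = g.red P ++ g.red Q := List.map_append ..

/-- `red` keeps the length. [folklore] -/
@[simp] theorem length_red (P : List ℕ) : (g.red P).length = P.length := List.length_map ..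

/-- `red` of a singleton. [folklore] -/
@[simp] theorem red_singleton (v : ℕ) : g.red [v] = [v % g.Pw] := rfl

/-- `red` of a cons. [folklore] -/
@[simp] theorem red_cons (v : ℕ) (P : List ℕ) : g.red (v :: P) = v % g.Pw :: g.red P := rfl

/-- `red` of nil. [folklore] -/
@[simp] theorem red_nil : g.red [] = [] := rfl

/-- The state after a prefix `P` has been emitted: registers, environment registers, the emission
pointer past the prefix, and the data = relocated input with `red P` written from `Bv`. [folklore] -/
structure Emitted (P : List ℕ) (m : ℕ → ℕ) : Prop where
  regs : g.Regs m
  eregs : g.ERegs m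
  r30 : m 30 = g.Bv + P.length
  data : ∀ a, 100 ≤ a → m a = writeFrom g.Bv (g.red P) (relocated g.x) a

/-- **The header.** From the registers and untouched data, `header` emits `P0`. [folklore] -/
theorem header_spec (hF : g.Fits W) {m : ℕ → ℕ} (hR : g.Regs m) (hE : g.ERegs m)
    (hD : ∀ a, 100 ≤ a → m a = relocated g.x a) :
    Achieves W O header m (g.Emitted g.P0) 16 := by
  obtain ⟨hX, hBv, hSv, htop, hV, hLy, hPw1, hPwW, hLx2, hndLx, hnE, hdE, hndE, hnV, hnEdef, hLxdef, hnVdef⟩ :=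
    g.facts hF
  obtain ⟨r0, r2, r3, r4, r5, r6, r10⟩ := hR
  obtain ⟨r11, r12, r13⟩ := hE
  refine achieves_block_of_eq (fun m' hm' => ?_) (by simp [emit])
  simp (disch := first | omega | decide) only [emit, List.cons_append, List.nil_append,
    execOps_cons, execOps_nil, execOp, Operand.write,
    Operand.read, merge_apply_of_lt, update_merge_of_lt, update_merge_of_le, Function.update_self,
    Function.update_of_ne, BinOp.eval_add_of_lt, BinOp.eval_mod, BinOp.eval_band, Nat.and_self,
    r4, r5, r6, r10, r13] at hm'
  subst hm'
  refine ⟨⟨?_, ?_, ?_, ?_, ?_, ?_, ?_⟩, ⟨?_, ?_, ?_⟩, ?_, fun a ha => ?_⟩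
  all_goals (try simp (disch := first | omega | decide) only [merge_apply_of_lt,
    merge_apply_of_le, Function.update_self, Function.update_of_ne])
  any_goals assumption
  · simp [P0]
  · rw [← writeFrom_nil g.Bv m, update_writeFrom_of_eq _ (by simp), update_writeFrom_of_eq _ (by simp),
      update_writeFrom_of_eq _ (by simp), update_writeFrom_of_eq _ (by simp),
      update_writeFrom_of_eq _ (by simp)]
    exact writeFrom_apply_congr _ (hD a ha)

/-- **Emitting one word, pointwise on the data**: writing `v % Pw` at the emission pointer extends
the emitted prefix by `v`. [folklore] -/
theorem emit_data {P : List ℕ} {m : ℕ → ℕ} {A : ℕ} (v : ℕ)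
    (hd : ∀ a, 100 ≤ a → m a = writeFrom g.Bv (g.red P) (relocated g.x) a) (hA : A = g.Bv + P.length) :
    ∀ a, 100 ≤ a →
      Function.update m A (v % g.Pw) a = writeFrom g.Bv (g.red (P ++ [v])) (relocated g.x) a := by
  intro a ha
  rw [red_append, red_singleton, ← update_writeFrom, length_red, ← hA]
  by_cases h : a = A
  · subst h; rw [Function.update_self, Function.update_self]
  · rw [Function.update_of_ne h, Function.update_of_ne h, hd a ha]

/-! ### The hub–coordinate entries -/

/-- The words of the first `j` hub–coordinate pairs. [folklore] -/
def prefC (j : ℕ) : List ℕ := (List.range j).flatMap fun j' => [0, 2 + j', 1, 2 + j']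

/-- `prefC` has `4 j` words. [folklore] -/
@[simp] theorem length_prefC (j : ℕ) : (prefC j).length = 4 * j := by
  simp [prefC, List.length_flatMap]; ring

/-- Stepping `prefC`. [folklore] -/
theorem prefC_succ (j : ℕ) : prefC (j + 1) = prefC j ++ [0, 2 + j, 1, 2 + j] := by
  simp [prefC, List.range_succ, List.flatMap_append]

/-- `prefC d` is `wordsC`. [folklore] -/
theorem prefC_d : prefC g.I.d = wordsC g.I := rfl

/-- `P0` has `5` words. [folklore] -/
@[simp] theorem length_P0 : g.P0.length = 5 := rfl

/-- **The hub–coordinate loop.** From the state after the header, `loopC` emits `wordsC`.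
[folklore] -/
theorem loopC_spec (hF : g.Fits W) {m : ℕ → ℕ} (hm : g.Emitted g.P0 m) :
    Achieves W O loopC m (g.Emitted (g.P0 ++ wordsC g.I)) (2 + (g.I.d * (15 + 2) + 1)) := by
  obtain ⟨hX, hBv, hSv, htop, hV, hLy, hPw1, hPwW, hLx2, hndLx, hnE, hdE, hndE, hnV, hnEdef, hLxdef, hnVdef⟩ :=
    g.facts hF
  have hdLy : 4 + 4 * g.I.d ≤ g.Ly := by omega
  obtain ⟨⟨r0, r2, r3, r4, r5, r6, r10⟩, ⟨r11, r12, r13⟩, r30, hD⟩ := hm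
  unfold loopC
  -- initialise `j := 0`, counter `:= d`
  refine Achieves.seqs_cons (R := fun m₁ => g.Emitted (g.P0 ++ prefC 0) m₁ ∧ m₁ 35 = 0 ∧
      m₁ 34 = g.I.d - 0) (T₁ := 2) ?_ ?_
  · refine achieves_block_of_eq (fun m' hm' => ?_) le_rfl
    simp (disch := first | omega | decide) only [execOps_cons, execOps_nil, execOp, Operand.write,
      Operand.read, merge_apply_of_lt, update_merge_of_lt,
      Function.update_of_ne, BinOp.eval_band, Nat.and_self, r3] at hm'
    subst hm'
    refine ⟨⟨⟨?_, ?_, ?_, ?_, ?_, ?_, ?_⟩, ⟨?_, ?_, ?_⟩, ?_, fun a ha => ?_⟩, ?_, ?_⟩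
    all_goals (try simp (disch := first | omega | decide) only [merge_apply_of_lt,
      merge_apply_of_le, Function.update_self, Function.update_of_ne])
    any_goals assumption
    all_goals first | (rw [hD _ ‹_›]; simp [prefC]) | omega
  rintro m₁ ⟨hm₁, h35, h34⟩
  refine Achieves.seqs_cons (T₂ := 0) ?_ (fun _ h => Achieves.seqs_nil h)
  refine Achieves.whilenz g.I.d 15
    (fun j m' => g.Emitted (g.P0 ++ prefC j) m' ∧ m' 35 = j ∧ m' 34 = g.I.d - j)
    (fun j hj m' ⟨hE, q35, q34⟩ => ⟨?_, ?_⟩) (fun m' ⟨_, _, q34⟩ => ?_) ⟨hm₁, h35, h34⟩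
    (fun m' ⟨hE, _, _⟩ => by rw [prefC_d] at hE; exact hE) le_rfl
  · -- the test reads nonzero
    simp only [Operand.read, q34]; omega
  · -- the body
    obtain ⟨⟨q0, q2, q3, q4, q5, q6, q10⟩, ⟨q11, q12, q13⟩, q30, qD⟩ := hE
    have hlen : (g.P0 ++ prefC j).length = 5 + 4 * j := by simp
    rw [hlen] at q30
    refine achieves_block_of_eq (fun m'' hm'' => ?_) (by simp [emit])
    simp (disch := first | omega | decide) only [emit, List.cons_append, List.nil_append,
      execOps_cons, execOps_nil, execOp, Operand.write, Operand.read, merge_apply_of_lt,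
      update_merge_of_lt, update_merge_of_le, Function.update_self, Function.update_of_ne,
      BinOp.eval_add_of_lt, BinOp.eval_sub_of_le, BinOp.eval_mod, BinOp.eval_band, Nat.and_self,
      q30, q35, q34, q13] at hm''
    subst hm''
    refine ⟨⟨⟨?_, ?_, ?_, ?_, ?_, ?_, ?_⟩, ⟨?_, ?_, ?_⟩, ?_, fun a ha => ?_⟩, ?_, ?_⟩
    all_goals (try simp (disch := first | omega | decide) only [merge_apply_of_lt,
      merge_apply_of_le, Function.update_self, Function.update_of_ne])
    any_goals assumption
    · simp [prefC_succ]; omega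
    · have h4 := g.emit_data (A := g.Bv + (5 + 4 * j) + 1 + 1 + 1) (2 + j)
        (g.emit_data (A := g.Bv + (5 + 4 * j) + 1 + 1) 1
          (g.emit_data (A := g.Bv + (5 + 4 * j) + 1) (2 + j)
            (g.emit_data (A := g.Bv + (5 + 4 * j)) 0 qD (by simp)) (by simp; omega)) (by simp; omega))
        (by simp; omega) a ha
      rw [h4, prefC_succ]
      simp [List.append_assoc]
    · omega
  · -- exit
    simp only [Operand.read, q34]; omega

/-! ### The coordinate entries of one vector block -/

/-- The words of the first `j` coordinate entries of a vector block with vertex `sv` and bits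
`bit`. [folklore] -/
def prefJ (sv : ℕ) (bit : ℕ → Bool) (j : ℕ) : List ℕ :=
  (List.range j).flatMap fun j' => [sv, if bit j' then 2 + j' else sv]

/-- `prefJ` has `2 j` words. [folklore] -/
@[simp] theorem length_prefJ (sv : ℕ) (bit : ℕ → Bool) (j : ℕ) : (prefJ sv bit j).length = 2 * j := by
  simp [prefJ, List.length_flatMap]; ring

/-- Stepping `prefJ`. [folklore] -/
theorem prefJ_succ (sv : ℕ) (bit : ℕ → Bool) (j : ℕ) :
    prefJ sv bit (j + 1) = prefJ sv bit j ++ [sv, if bit j then 2 + j else sv] := by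
  simp [prefJ, List.range_succ, List.flatMap_append]

/-- **The coordinate loop of a vector block.** From a state in which the prefix `P` has been
emitted, `r36 = sv` (the vector vertex), `j = 0`, counter `d`, and the read pointer at the `d`
bits `bit 0, …, bit (d-1)` of the input (`x[rb + j]`), the loop `whilenz (r 34) bodyJ` emits
`prefJ sv bit d`, advances the read pointer by `d`, and keeps `r32, r33, r36`. [folklore] -/
theorem loopJ_spec (hF : g.Fits W) {P : List ℕ} {sv rb c32 c33 : ℕ} {bit : ℕ → Bool} {m : ℕ → ℕ}
    (hE : g.Emitted P m) (h36 : m 36 = sv) (h35 : m 35 = 0) (h34 : m 34 = g.I.d)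
    (h31 : m 31 = g.X + rb) (h32 : m 32 = c32) (h33 : m 33 = c33) (hrb : rb + g.I.d ≤ g.Lx)
    (hbit : ∀ j, j < g.I.d → g.x.getD (rb + j) 0 = (bit j).toNat) (hsv : sv ≤ g.Ly)
    (hP : P.length + 2 * g.I.d ≤ g.Ly + 1) :
    Achieves W O (whilenz (r 34) bodyJ) m
      (fun m' => g.Emitted (P ++ prefJ sv bit g.I.d) m' ∧ m' 36 = sv ∧ m' 31 = g.X + rb + g.I.d ∧
        m' 32 = c32 ∧ m' 33 = c33) (g.I.d * (15 + 2) + 1) := by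
  obtain ⟨hX, hBv, hSv, htop, hV, hLy, hPw1, hPwW, hLx2, hndLx, hnE, hdE, hndE, hnV, hnEdef, hLxdef, hnVdef⟩ :=
    g.facts hF
  have hW : W < 2 ^ W := Nat.lt_two_pow_self
  refine Achieves.whilenz g.I.d 15
    (fun j m' => g.Emitted (P ++ prefJ sv bit j) m' ∧ m' 36 = sv ∧ m' 35 = j ∧ m' 34 = g.I.d - j ∧
      m' 31 = g.X + rb + j ∧ m' 32 = c32 ∧ m' 33 = c33)
    (fun j hj m' ⟨hEj, q36, q35, q34, q31, q32, q33⟩ => ⟨?_, ?_⟩) (fun m' ⟨_, _, _, q34, _⟩ => ?_)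
    ⟨by simpa [prefJ] using hE, h36, h35, h34, by rw [h31, Nat.add_zero], h32, h33⟩
    (fun m' ⟨hEd, q36, _, _, q31, q32, q33⟩ => ⟨hEd, q36, q31, q32, q33⟩) le_rfl
  · -- the test reads nonzero
    simp only [Operand.read, q34]; omega
  · -- the body
    obtain ⟨⟨q0, q2, q3, q4, q5, q6, q10⟩, ⟨q11, q12, q13⟩, q30, qD⟩ := hEj
    have hlen : (P ++ prefJ sv bit j).length = P.length + 2 * j := by simp
    rw [hlen] at q30
    have hread : m' (g.X + rb + j) = (bit j).toNat := by
      rw [qD _ (by omega), writeFrom_of_lt _ _ (by omega), show g.X + rb + j = g.X + (rb + j) by omega,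
        relocated_X_add, hbit j hj]
    cases hb : bit j <;> simp only [hb, Bool.toNat_false, Bool.toNat_true] at hread
    all_goals
      refine achieves_block_of_eq (fun m'' hm'' => ?_) (by simp [emit])
      simp (disch := first | omega | decide) only [emit, List.cons_append, List.nil_append,
        execOps_cons, execOps_nil, execOp, Operand.write, Operand.read, merge_apply_of_lt,
        merge_apply_of_le, update_merge_of_lt, update_merge_of_le, Function.update_self,
        Function.update_of_ne, BinOp.eval_add_of_lt, BinOp.eval_sub_of_le, BinOp.eval_mul_of_lt,
        BinOp.eval_mod, BinOp.eval_band, Nat.and_self, Nat.zero_mul, Nat.one_mul,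
        Nat.sub_zero, Nat.sub_self, Nat.zero_add, Nat.add_zero, q30, q31, q34, q35, q36, q13,
        hread] at hm''
      subst hm''
      refine ⟨⟨⟨?_, ?_, ?_, ?_, ?_, ?_, ?_⟩, ⟨?_, ?_, ?_⟩, ?_, fun a ha => ?_⟩, ?_, ?_, ?_, ?_, ?_, ?_⟩
      all_goals (try simp (disch := first | omega | decide) only [merge_apply_of_lt,
        merge_apply_of_le, Function.update_self, Function.update_of_ne])
      any_goals assumption
      any_goals omega
    · simp [prefJ_succ]; omega
    · have h2 := g.emit_data (A := g.Bv + (P.length + 2 * j) + 1) sv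
        (g.emit_data (A := g.Bv + (P.length + 2 * j)) sv qD (by simp)) (by simp; omega) a ha
      rw [h2, prefJ_succ, hb]
      simp [List.append_assoc]
    · simp [prefJ_succ]; omega
    · have h2 := g.emit_data (A := g.Bv + (P.length + 2 * j) + 1) (2 + j)
        (g.emit_data (A := g.Bv + (P.length + 2 * j)) sv qD (by simp)) (by simp; omega) a ha
      rw [h2, prefJ_succ, hb]
      simp [List.append_assoc]
  · -- exit
    simp only [Operand.read, q34]; omega

/-! ### The vector blocks -/

variable {g} in
/-- `Emitted` survives changes confined to the registers `31–99`. [folklore] -/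
theorem Emitted.of_frame {P : List ℕ} {m m' : ℕ → ℕ} (h : g.Emitted P m)
    (hf : ∀ a, a ≤ 30 ∨ 100 ≤ a → m' a = m a) : g.Emitted P m' :=
  ⟨h.regs.of_frame fun a ha => hf a (Or.inl (by omega)),
    h.eregs.of_frame fun a _ ha => hf a (Or.inl (by omega)),
    (hf 30 (Or.inl le_rfl)).trans h.r30, fun a ha => (hf a (Or.inr ha)).trans (h.data a ha)⟩

/-- The prefix after the hub–coordinate entries. [folklore] -/
def PC : List ℕ := g.P0 ++ wordsC g.I

/-- `PC` has `5 + 4 d` words. [folklore] -/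
@[simp] theorem length_PC : g.PC.length = 5 + 4 * g.I.d := by
  simp [PC, length_wordsC]

/-- The words of the first `p` blocks of the first list. [folklore] -/
def prefA (p : ℕ) : List ℕ := (List.range p).flatMap (wordsA g.I)

/-- `prefA p` has `p (2 + 2d)` words. [folklore] -/
@[simp] theorem length_prefA (p : ℕ) : (g.prefA p).length = p * (2 + 2 * g.I.d) := by
  simp [prefA, List.length_flatMap, length_wordsA]

/-- Stepping `prefA`: block `p` is `0, a_p` followed by its coordinate entries. [folklore] -/
theorem prefA_succ (p : ℕ) : g.prefA (p + 1) =
    g.prefA p ++ ([0, 2 + g.I.d + p] ++ prefJ (2 + g.I.d + p) (bitA g.I p) g.I.d) := by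
  rw [show prefJ (2 + g.I.d + p) (bitA g.I p) g.I.d = (List.range g.I.d).flatMap (wordsAj g.I p) from rfl]
  simp [prefA, List.range_succ, List.flatMap_append, wordsA]

/-- The invariant of the loop over the first list at `p`: `prefA p` emitted after `PC`, `r33 = p`,
counter `n - p`, read pointer at bit `(p, 0)` of `A`. [folklore] -/
def InvA (p : ℕ) (m : ℕ → ℕ) : Prop :=
  g.Emitted (g.PC ++ g.prefA p) m ∧ m 33 = p ∧ m 32 = g.I.n - p ∧ m 31 = g.X + 2 + p * g.I.d

/-- **One block of the first list**: from `InvA p` (`p < n`), `bodyP 0 []` reaches `InvA (p + 1)`.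
[folklore] -/
theorem bodyA_spec (hF : g.Fits W) {p : ℕ} (hp : p < g.I.n) {m : ℕ → ℕ} (hm : g.InvA p m) :
    Achieves W O (bodyP 0 []) m (g.InvA (p + 1)) (10 + ((g.I.d * (15 + 2) + 1) + 2)) := by
  obtain ⟨hX, hBv, hSv, htop, hV, hLy, hPw1, hPwW, hLx2, hndLx, hnE, hdE, hndE, hnV, hnEdef, hLxdef, hnVdef⟩ :=
    g.facts hF
  obtain ⟨hEp, q33, q32, q31⟩ := hm
  have hpd : (p + 1) * g.I.d ≤ g.I.n * g.I.d := Nat.mul_le_mul_right _ hp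
  have hpd' : (p + 1) * g.I.d = p * g.I.d + g.I.d := Nat.succ_mul _ _
  have hp2 : (p + 1) * (2 + 2 * g.I.d) ≤ g.I.n * (2 + 2 * g.I.d) := Nat.mul_le_mul_right _ hp
  have hp2' : (p + 1) * (2 + 2 * g.I.d) = p * (2 + 2 * g.I.d) + (2 + 2 * g.I.d) := Nat.succ_mul _ _
  have hn2 : g.I.n * (2 + 2 * g.I.d) = 2 * (g.I.n * (1 + g.I.d)) := by ring
  obtain ⟨⟨q0, q2, q3, q4, q5, q6, q10⟩, ⟨q11, q12, q13⟩, q30, qD⟩ := hEp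
  have hlen : (g.PC ++ g.prefA p).length = 5 + 4 * g.I.d + p * (2 + 2 * g.I.d) := by simp
  rw [hlen] at q30
  unfold bodyP
  refine Achieves.seqs_cons (R := fun m₂ => g.Emitted (g.PC ++ g.prefA p ++ [0, 2 + g.I.d + p]) m₂ ∧
      m₂ 36 = 2 + g.I.d + p ∧ m₂ 35 = 0 ∧ m₂ 34 = g.I.d ∧ m₂ 31 = g.X + (2 + p * g.I.d) ∧
      m₂ 32 = g.I.n - p ∧ m₂ 33 = p) (T₁ := 10) ?_ ?_
  · refine achieves_block_of_eq (fun m'' hm'' => ?_) (by simp [emit])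
    simp (disch := omega) only [emit, List.cons_append, List.nil_append,
      execOps_cons, execOps_nil, execOp, Operand.write, Operand.read, merge_apply_of_lt,
      update_merge_of_lt, update_merge_of_le, Function.update_self, Function.update_of_ne,
      BinOp.eval_add_of_lt, BinOp.eval_mod, BinOp.eval_band, Nat.and_self, q3, q13, q30, q33] at hm''
    subst hm''
    refine ⟨⟨⟨?_, ?_, ?_, ?_, ?_, ?_, ?_⟩, ⟨?_, ?_, ?_⟩, ?_, fun a ha => ?_⟩, ?_, ?_, ?_, ?_, ?_, ?_⟩
    all_goals (try simp (disch := omega) only [merge_apply_of_lt,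
      merge_apply_of_le, Function.update_self, Function.update_of_ne])
    any_goals assumption
    any_goals omega
    · simp; omega
    · have h2 := g.emit_data (A := g.Bv + (5 + 4 * g.I.d + p * (2 + 2 * g.I.d)) + 1) (2 + g.I.d + p)
        (g.emit_data (A := g.Bv + (5 + 4 * g.I.d + p * (2 + 2 * g.I.d))) 0 qD (by simp)) (by simp; omega) a ha
      rw [h2]
      simp [List.append_assoc]
  rintro m₂ ⟨hE₂, p36, p35, p34, p31, p32, p33⟩
  refine Achieves.seqs_cons (g.loopJ_spec hF (bit := bitA g.I p) hE₂ p36 p35 p34 p31 p32 p33 (by omega)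
    (fun j hj => by rw [show 2 + p * g.I.d + j = 2 + (p * g.I.d + j) by omega]; exact g.x_getD_bitA hp hj)
    (by omega) (by simp; omega)) ?_
  rintro m₃ ⟨hE₃, -, s31, s32, s33⟩
  refine Achieves.seqs_cons (T₁ := 2) (T₂ := 0) ?_ (fun _ h => Achieves.seqs_nil h)
  refine achieves_block_of_eq (fun m'' hm'' => ?_) le_rfl
  simp (disch := omega) only [execOps_cons, execOps_nil, execOp, Operand.write,
    Operand.read, merge_apply_of_lt, update_merge_of_lt, Function.update_of_ne,
    BinOp.eval_add_of_lt, BinOp.eval_sub_of_le, s32, s33] at hm''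
  subst hm''
  refine ⟨?_, ?_, ?_, ?_⟩
  · rw [prefA_succ, ← List.append_assoc, ← List.append_assoc]
    exact hE₃.of_frame fun a ha => by
      rcases ha with ha | ha
      · rw [merge_apply_of_lt (by omega), Function.update_of_ne (by omega), Function.update_of_ne (by omega)]
      · rw [merge_apply_of_le ha]
  all_goals (try simp (disch := omega) only [merge_apply_of_lt, Function.update_self,
    Function.update_of_ne])
  · omega
  · rw [s31]; omega

/-- **The blocks of the first list.** From the state after the hub–coordinate entries with the read
pointer at the first bit of `A`, `loopP 0 []` emits `prefA n` and leaves the read pointer at the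
first bit of `B`. [folklore] -/
theorem loopA_spec (hF : g.Fits W) {m : ℕ → ℕ} (hE : g.Emitted g.PC m) (h31 : m 31 = g.X + 2) :
    Achieves W O (loopP 0 []) m
      (fun m' => g.Emitted (g.PC ++ g.prefA g.I.n) m' ∧ m' 31 = g.X + 2 + g.I.n * g.I.d)
      (2 + (g.I.n * (10 + ((g.I.d * (15 + 2) + 1) + 2) + 2) + 1)) := by
  obtain ⟨hX, hBv, hSv, htop, hV, hLy, hPw1, hPwW, hLx2, hndLx, hnE, hdE, hndE, hnV, hnEdef, hLxdef, hnVdef⟩ :=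
    g.facts hF
  obtain ⟨⟨r0, r2, r3, r4, r5, r6, r10⟩, ⟨r11, r12, r13⟩, r30, hD⟩ := hE
  rw [length_PC] at r30
  unfold loopP
  refine Achieves.seqs_cons (R := g.InvA 0) (T₁ := 2) ?_ ?_
  · refine achieves_block_of_eq (fun m' hm' => ?_) le_rfl
    simp (disch := omega) only [execOps_cons, execOps_nil, execOp, Operand.write,
      Operand.read, merge_apply_of_lt, update_merge_of_lt, Function.update_of_ne, BinOp.eval_band,
      Nat.and_self, r2] at hm'
    subst hm'
    refine ⟨⟨⟨?_, ?_, ?_, ?_, ?_, ?_, ?_⟩, ⟨?_, ?_, ?_⟩, ?_, fun a ha => ?_⟩, ?_, ?_, ?_⟩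
    all_goals (try simp (disch := omega) only [merge_apply_of_lt,
      merge_apply_of_le, Function.update_self, Function.update_of_ne])
    any_goals assumption
    all_goals first | (rw [hD _ ‹_›]; simp [prefA]) | (simp [prefA]; omega) | omega
  intro m₁ hm₁
  refine Achieves.seqs_cons (T₂ := 0) ?_ (fun _ h => Achieves.seqs_nil h)
  refine Achieves.whilenz g.I.n (10 + ((g.I.d * (15 + 2) + 1) + 2)) g.InvA
    (fun p hp m' hm' => ⟨?_, g.bodyA_spec hF hp hm'⟩) (fun m' ⟨_, _, q32, _⟩ => ?_) hm₁
    (fun m' ⟨hEn, _, _, q31⟩ => ⟨hEn, q31⟩) le_rfl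
  · obtain ⟨-, -, q32, -⟩ := hm'
    simp only [Operand.read, q32]; omega
  · simp only [Operand.read, q32]; omega

/-- The prefix after the blocks of the first list. [folklore] -/
def PA : List ℕ := g.PC ++ g.prefA g.I.n

/-- `PA` has `5 + 4 d + n (2 + 2d)` words. [folklore] -/
@[simp] theorem length_PA : g.PA.length = 5 + 4 * g.I.d + g.I.n * (2 + 2 * g.I.d) := by
  simp [PA]

/-- The words of the first `q` blocks of the second list. [folklore] -/
def prefB (q : ℕ) : List ℕ := (List.range q).flatMap (wordsB g.I)

/-- `prefB q` has `q (2 + 2d)` words. [folklore] -/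
@[simp] theorem length_prefB (q : ℕ) : (g.prefB q).length = q * (2 + 2 * g.I.d) := by
  simp [prefB, List.length_flatMap, length_wordsB]

/-- Stepping `prefB`: block `q` is `1, b_q` followed by its coordinate entries. [folklore] -/
theorem prefB_succ (q : ℕ) : g.prefB (q + 1) =
    g.prefB q ++ ([1, 2 + g.I.d + g.I.n + q] ++ prefJ (2 + g.I.d + g.I.n + q) (bitB g.I q) g.I.d) := by
  rw [show prefJ (2 + g.I.d + g.I.n + q) (bitB g.I q) g.I.d = (List.range g.I.d).flatMap (wordsBj g.I q)
    from rfl]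
  simp [prefB, List.range_succ, List.flatMap_append, wordsB]

/-- The invariant of the loop over the second list at `q`: `prefB q` emitted after `PA`, `r33 = q`,
counter `n - q`, read pointer at bit `(q, 0)` of `B`. [folklore] -/
def InvB (q : ℕ) (m : ℕ → ℕ) : Prop :=
  g.Emitted (g.PA ++ g.prefB q) m ∧ m 33 = q ∧ m 32 = g.I.n - q ∧
    m 31 = g.X + 2 + g.I.n * g.I.d + q * g.I.d

/-- **One block of the second list**: from `InvB q` (`q < n`), `bodyP 1 [r36 += n]` reaches
`InvB (q + 1)`. [folklore] -/
theorem bodyB_spec (hF : g.Fits W) {q : ℕ} (hq : q < g.I.n) {m : ℕ → ℕ} (hm : g.InvB q m) :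
    Achieves W O (bodyP 1 [(.add, r 36, r 36, r 2)]) m (g.InvB (q + 1)) (11 + ((g.I.d * (15 + 2) + 1) + 2)) := by
  obtain ⟨hX, hBv, hSv, htop, hV, hLy, hPw1, hPwW, hLx2, hndLx, hnE, hdE, hndE, hnV, hnEdef, hLxdef, hnVdef⟩ :=
    g.facts hF
  obtain ⟨hEq, q33, q32, q31⟩ := hm
  have hqd : (q + 1) * g.I.d ≤ g.I.n * g.I.d := Nat.mul_le_mul_right _ hq
  have hqd' : (q + 1) * g.I.d = q * g.I.d + g.I.d := Nat.succ_mul _ _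
  have hq2 : (q + 1) * (2 + 2 * g.I.d) ≤ g.I.n * (2 + 2 * g.I.d) := Nat.mul_le_mul_right _ hq
  have hq2' : (q + 1) * (2 + 2 * g.I.d) = q * (2 + 2 * g.I.d) + (2 + 2 * g.I.d) := Nat.succ_mul _ _
  have hn2 : g.I.n * (2 + 2 * g.I.d) = 2 * (g.I.n * (1 + g.I.d)) := by ring
  obtain ⟨⟨q0, q2, q3, q4, q5, q6, q10⟩, ⟨q11, q12, q13⟩, q30, qD⟩ := hEq
  have hlen : (g.PA ++ g.prefB q).length = 5 + 4 * g.I.d + g.I.n * (2 + 2 * g.I.d) + q * (2 + 2 * g.I.d) := by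
    simp
  rw [hlen] at q30
  unfold bodyP
  refine Achieves.seqs_cons (R := fun m₂ => g.Emitted (g.PA ++ g.prefB q ++ [1, 2 + g.I.d + g.I.n + q]) m₂ ∧
      m₂ 36 = 2 + g.I.d + g.I.n + q ∧ m₂ 35 = 0 ∧ m₂ 34 = g.I.d ∧
      m₂ 31 = g.X + (2 + g.I.n * g.I.d + q * g.I.d) ∧ m₂ 32 = g.I.n - q ∧ m₂ 33 = q) (T₁ := 11) ?_ ?_
  · refine achieves_block_of_eq (fun m'' hm'' => ?_) (by simp [emit])
    simp (disch := omega) only [emit, List.cons_append, List.nil_append,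
      execOps_cons, execOps_nil, execOp, Operand.write, Operand.read, merge_apply_of_lt,
      update_merge_of_lt, update_merge_of_le, Function.update_self, Function.update_of_ne,
      BinOp.eval_add_of_lt, BinOp.eval_mod, BinOp.eval_band, Nat.and_self, q2, q3, q13, q30, q33] at hm''
    subst hm''
    refine ⟨⟨⟨?_, ?_, ?_, ?_, ?_, ?_, ?_⟩, ⟨?_, ?_, ?_⟩, ?_, fun a ha => ?_⟩, ?_, ?_, ?_, ?_, ?_, ?_⟩
    all_goals (try simp (disch := omega) only [merge_apply_of_lt,
      merge_apply_of_le, Function.update_self, Function.update_of_ne])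
    any_goals assumption
    any_goals omega
    · simp; omega
    · have h2 := g.emit_data (A := g.Bv + (5 + 4 * g.I.d + g.I.n * (2 + 2 * g.I.d) + q * (2 + 2 * g.I.d)) + 1)
        (2 + g.I.d + g.I.n + q)
        (g.emit_data (A := g.Bv + (5 + 4 * g.I.d + g.I.n * (2 + 2 * g.I.d) + q * (2 + 2 * g.I.d))) 1 qD
          (by simp)) (by simp; omega) a ha
      rw [h2]
      simp [List.append_assoc]
  rintro m₂ ⟨hE₂, p36, p35, p34, p31, p32, p33⟩
  refine Achieves.seqs_cons (g.loopJ_spec hF (bit := bitB g.I q) hE₂ p36 p35 p34 p31 p32 p33 (by omega)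
    (fun j hj => by
      rw [show 2 + g.I.n * g.I.d + q * g.I.d + j = 2 + (g.I.n * g.I.d + (q * g.I.d + j)) by omega]
      exact g.x_getD_bitB hq hj)
    (by omega) (by simp; omega)) ?_
  rintro m₃ ⟨hE₃, -, s31, s32, s33⟩
  refine Achieves.seqs_cons (T₁ := 2) (T₂ := 0) ?_ (fun _ h => Achieves.seqs_nil h)
  refine achieves_block_of_eq (fun m'' hm'' => ?_) le_rfl
  simp (disch := omega) only [execOps_cons, execOps_nil, execOp, Operand.write,
    Operand.read, merge_apply_of_lt, update_merge_of_lt, Function.update_of_ne,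
    BinOp.eval_add_of_lt, BinOp.eval_sub_of_le, s32, s33] at hm''
  subst hm''
  refine ⟨?_, ?_, ?_, ?_⟩
  · rw [prefB_succ, ← List.append_assoc, ← List.append_assoc]
    exact hE₃.of_frame fun a ha => by
      rcases ha with ha | ha
      · rw [merge_apply_of_lt (by omega), Function.update_of_ne (by omega), Function.update_of_ne (by omega)]
      · rw [merge_apply_of_le ha]
  all_goals (try simp (disch := omega) only [merge_apply_of_lt, Function.update_self,
    Function.update_of_ne])
  · omega
  · rw [s31]; omega

/-- **The blocks of the second list.** From the state after the first list with the read pointer at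
the first bit of `B`, `loopP 1 [r36 += n]` emits `prefB n`. [folklore] -/
theorem loopB_spec (hF : g.Fits W) {m : ℕ → ℕ} (hE : g.Emitted g.PA m)
    (h31 : m 31 = g.X + 2 + g.I.n * g.I.d) :
    Achieves W O (loopP 1 [(.add, r 36, r 36, r 2)]) m (g.Emitted (g.PA ++ g.prefB g.I.n))
      (2 + (g.I.n * (11 + ((g.I.d * (15 + 2) + 1) + 2) + 2) + 1)) := by
  obtain ⟨hX, hBv, hSv, htop, hV, hLy, hPw1, hPwW, hLx2, hndLx, hnE, hdE, hndE, hnV, hnEdef, hLxdef, hnVdef⟩ :=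
    g.facts hF
  obtain ⟨⟨r0, r2, r3, r4, r5, r6, r10⟩, ⟨r11, r12, r13⟩, r30, hD⟩ := hE
  rw [length_PA] at r30
  unfold loopP
  refine Achieves.seqs_cons (R := g.InvB 0) (T₁ := 2) ?_ ?_
  · refine achieves_block_of_eq (fun m' hm' => ?_) le_rfl
    simp (disch := omega) only [execOps_cons, execOps_nil, execOp, Operand.write,
      Operand.read, merge_apply_of_lt, update_merge_of_lt, Function.update_of_ne, BinOp.eval_band,
      Nat.and_self, r2] at hm'
    subst hm'
    refine ⟨⟨⟨?_, ?_, ?_, ?_, ?_, ?_, ?_⟩, ⟨?_, ?_, ?_⟩, ?_, fun a ha => ?_⟩, ?_, ?_, ?_⟩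
    all_goals (try simp (disch := omega) only [merge_apply_of_lt,
      merge_apply_of_le, Function.update_self, Function.update_of_ne])
    any_goals assumption
    all_goals first | (rw [hD _ ‹_›]; simp [prefB]) | (simp [prefB]; omega) | omega
  intro m₁ hm₁
  refine Achieves.seqs_cons (T₂ := 0) ?_ (fun _ h => Achieves.seqs_nil h)
  refine Achieves.whilenz g.I.n (11 + ((g.I.d * (15 + 2) + 1) + 2)) g.InvB
    (fun q hq m' hm' => ⟨?_, g.bodyB_spec hF hq hm'⟩) (fun m' ⟨_, _, q32, _⟩ => ?_) hm₁
    (fun m' ⟨hEn, _, _, _⟩ => hEn) le_rfl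
  · obtain ⟨-, -, q32, -⟩ := hm'
    simp only [Operand.read, q32]; omega
  · simp only [Operand.read, q32]; omega

/-! ### The whole build -/

/-- All emitted words: the header, the hub–coordinate entries, both vector lists. [folklore] -/
def PB : List ℕ := g.PA ++ g.prefB g.I.n

/-- **The emitted words are the Diameter input preceded by its length.** [folklore] -/
theorem PB_eq : g.PB = g.Ly :: g.yv := by
  simp [PB, PA, PC, P0, prefA, prefB, yv, y_eq, body, nE, List.append_assoc]

/-- `red PB` is `emitted`. [folklore] -/
theorem red_PB : g.red g.PB = g.emitted := by rw [PB_eq]; rfl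

/-- **The final memory of the build**: environment registers `Bv, Sv, 0, Pw`, all other registers
`0`, the relocated input, and the emitted words from `Bv` on. [folklore] -/
noncomputable def finMem (a : ℕ) : ℕ :=
  if a < 100 then (if a = 10 then g.Bv else if a = 11 then g.Sv else if a = 13 then g.Pw else 0)
  else writeFrom g.Bv g.emitted (relocated g.x) a

/-- The time of the build. [folklore] -/
noncomputable def Tpre : ℕ :=
  7 * g.Lx + 17 + (Nat.size g.Ly * 4 + 1) + 8 + 16 + (2 + (g.I.d * (15 + 2) + 1)) + 1 +
    (2 + (g.I.n * (10 + ((g.I.d * (15 + 2) + 1) + 2) + 2) + 1)) +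
    (2 + (g.I.n * (11 + ((g.I.d * (15 + 2) + 1) + 2) + 2) + 1)) + 96

/-- **The build.** On the initial memory of the input `x = OV.encode I` (word size `W` with
`g.Fits W`), `pre` ends, within `Tpre` steps, in the closed-form memory `finMem`. [folklore] -/
theorem pre_spec (hF : g.Fits W) :
    Achieves W O (pre g.kM g.cM) (initFun g.x) (fun m => m = g.finMem) g.Tpre := by
  obtain ⟨hX, hBv, hSv, htop, hV, hLy, hPw1, hPwW, hLx2, hndLx, hnE, hdE, hndE, hnV, hnEdef, hLxdef, hnVdef⟩ :=
    g.facts hF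
  unfold pre Tpre
  refine Achieves.mono (T := 7 * g.Lx + (17 + ((Nat.size g.Ly * 4 + 1) + (8 + (16 +
    ((2 + (g.I.d * (15 + 2) + 1)) + (1 + ((2 + (g.I.n * (10 + ((g.I.d * (15 + 2) + 1) + 2) + 2) + 1)) +
    ((2 + (g.I.n * (11 + ((g.I.d * (15 + 2) + 1) + 2) + 2) + 1)) + (96 + 0)))))))))) ?_ (fun _ h => h) (by omega)
  -- relocate
  refine Achieves.seqs_cons (R := fun m => m = relocated g.x) (T₁ := 7 * g.Lx)
    (fun qs => ⟨relocated g.x, 7 * g.Lx, le_rfl, ?_, rfl⟩) ?_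
  · unfold Lx at hLx2 hBv hX
    exact relocate_exec (by omega) hF.input (by omega) qs
  rintro m rfl
  -- setup
  refine Achieves.seqs_cons (g.setupA_spec hF) ?_
  rintro m₁ ⟨hR₁, h21, h22, hD₁⟩
  refine Achieves.seqs_cons (CliqueRed.Params.sizeLoop_spec (O := O) h21 h22 (by omega)) ?_
  rintro m₂ ⟨s22, -, sf⟩
  have hR₂ : g.Regs m₂ := hR₁.of_frame fun a ha => sf a (by omega) (by omega)
  have hD₂ : ∀ a, 100 ≤ a → m₂ a = relocated g.x a := fun a ha => by
    rw [sf a (by omega) (by omega), hD₁ a ha]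
  refine Achieves.seqs_cons (g.setupV_spec hF hR₂ s22 hD₂) ?_
  rintro m₃ ⟨hR₃, hE₃, hD₃⟩
  -- emission
  refine Achieves.seqs_cons (g.header_spec hF hR₃ hE₃ hD₃) fun m₄ h₄ => ?_
  refine Achieves.seqs_cons (g.loopC_spec hF h₄) fun m₅ h₅ => ?_
  refine Achieves.seqs_cons (R := fun m₆ => g.Emitted g.PC m₆ ∧ m₆ 31 = g.X + 2) (T₁ := 1) ?_ ?_
  · have r0 := h₅.regs.r0
    refine achieves_block_of_eq (fun m' hm' => ?_) le_rfl
    simp (disch := omega) only [execOps_cons, execOps_nil, execOp, Operand.write,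
      Operand.read, merge_apply_of_lt, update_merge_of_lt, BinOp.eval_add_of_lt, r0] at hm'
    subst hm'
    refine ⟨h₅.of_frame fun a ha => ?_, by simp (disch := omega) only [merge_apply_of_lt, Function.update_self]⟩
    rcases ha with ha | ha
    · rw [merge_apply_of_lt (by omega), Function.update_of_ne (by omega)]
    · rw [merge_apply_of_le ha]
  rintro m₆ ⟨hE₆, h31⟩
  refine Achieves.seqs_cons (g.loopA_spec hF hE₆ h31) ?_
  rintro m₇ ⟨hE₇, h31'⟩
  refine Achieves.seqs_cons (g.loopB_spec hF hE₇ h31') fun m₈ hE₈ => ?_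
  -- clearing
  refine Achieves.seqs_cons (T₁ := 96) (T₂ := 0) ?_ fun _ h => Achieves.seqs_nil h
  refine Achieves.block ?_ (by rw [List.length_map, length_clearedRegs])
  show execOps W m₈ (clearedRegs.map fun i => ((.band, r i, im 0, im 0) : OpSpec)) = g.finMem
  rw [execOps_clear]
  funext a
  unfold finMem
  simp only [mem_clearedRegs]
  by_cases ha : a < 100
  · rw [if_pos ha]
    by_cases h10 : a = 10; · subst h10; simp [hE₈.regs.r10]
    by_cases h11 : a = 11; · subst h11; simp [hE₈.eregs.r11]
    by_cases h12 : a = 12; · subst h12; simp [hE₈.eregs.r12]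
    by_cases h13 : a = 13; · subst h13; simp [hE₈.eregs.r13]
    rw [if_pos ⟨ha, by omega⟩, if_neg h10, if_neg h11, if_neg h13]
  · rw [if_neg (by omega), if_neg ha, hE₈.data a (by omega), ← red_PB]; rfl

end Params

end DiamRed

end Literature.Computability.FineGrained
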